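import Summits.QuantumFields.YangMills.Theorems.UnitScaleTiltProp8ChartTransport
import HarnessLib

/-!
# Route `UnitScaleTilt`, crux K1 «MinimiserStabilityRegPr» (stmt-QuantumFields-19200), leaf V2′ `stub_halvingStep` — pillar P3 `ChartPerLevel`:
# **[Balaban1985Averaging] PROP. 3 AT THE FLAT BACKGROUND FOR THE UNGUARDED (0.4) AVERAGE ON `𝔸ˣ`-VALUED (COMPLEXIFIED) FIELDS, IN FACTORISED FORM**
# (file 2 of 2; segment and loop letters in `…Prop8ChartTransport`)

Cell `ym3-torus` ∕ fleet seat `ym-ust-19200-p2` g6 (v8 PEN).  The tree's Prop. 3 (p482040 `BlockAveragingEMLLinearised.norm_avgFun_sub_one_sub_linAvg_le`) is for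
`SU(N)` fields and the GUARDED average.  This file is its twin for the unguarded `Prop8Chart.emlAvgU` on `𝔸ˣ` (any complete normed `ℂ`-algebra with `‖1‖ = 1`),
with the hypothesis only on the bonds the average READS (both ends in the two blocks of `c`), and with the conclusion also in the FACTORISED form the k-uniform
engine of P3 iterates:
* §4 **`norm_emlAvgU_sub_one_sub_lin_le`**: `‖Ū(c) − 1 − Lin_c(Z)‖ ≤ 660·(ℓs)²` and `‖Ū(c) − 1‖ ≤ 17·ℓs` for `‖S(b) − 1‖ ≤ s` on the two-block bonds,
  `48ℓs ≤ 1`, `ℓ = (d+2)L`, `Lin_c(Z) = |I|⁻¹ Σ_{(n,σ,σ′)} [Z(Γ^σ_{y→x}) + Z([x,x′]) − Z(Γ^{σ′}_{y′→x′})]`;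
* §5 **`norm_conj_emlAvgU_sub_one_le`** (THE FACTORISED ONE STEP): with the block comb means `λ̄(y) = |I|⁻¹ Σ Z(Γ^σ_{y→x})` and the coarse gauge `g = exp λ̄`:
  `‖g(c₋)⁻¹·Ū(c)·g(c₊) − 1‖ ≤ L·s + 800·(ℓs)²`, `‖λ̄‖ ≤ ℓs` — conjugating away the comb means leaves the mean of the straight segments `[x, x′]` (`L` bonds
  each) to first order, WITH CONSTANT EXACTLY `L`: the nonlinear one-step twin of `Q₁ = L·Q − d(λ̄)` (p482040 `linAvg_eq_bondAvg_sub_grad_combMean`).  Iterated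
  with the covariance `emlAvgU (S^H) = (emlAvgU S)^{H∘emb}` (p547331) it propagates near-flatness through the levels with loss `×L` per level and summable
  second-order corrections — the k-uniform smallness hCd/hCq of `ChartRemainderAt` start from;
* §6 the same in the tree's matrix letters `linAvg` / `combMean`.
Sorry-free, definition-free.  NOT a claim about the mass gap.

References: T. Bałaban, CMP **98** (1985) 17–51 [Balaban1985Averaging] (Prop. 3 (122)–(125) p.36, (62)–(63) p.28); CMP **109** (1987) 249–301 [Balaban1987RG1]
((0.3)–(0.4) pp.252–253); CMP **102** (1985) 277–309 [Balaban1985Variational] ((44)–(48) p.285, (152) p.301).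
-/

noncomputable section

open scoped BigOperators
open NormedSpace

namespace Summit.QuantumFields.YangMills.Theorems.Prop8Chart

open Literature.MathematicalPhysics.QuantumFieldTheory.Balaban1983to89
open T4Continuum BlockAveraging AveragingRT ExpMeanLog MatrixLog BlockAveragingEMLLinearised
open B10Eq27TorusAxialLog (holT holT_nil holT_cons_true holT_cons_false)
open B7TransferAnalyticMean (meanCLM meanCLM_apply norm_exp_sub_one_le_two_mul norm_exp_sub_one_sub_self_le)
open BlockAveragingEMLAnalyticMean (norm_eml_one_add_sub_sub_mean_le)
open LatticeWordStokes (length_loopWord_le)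

variable {P : Params} {j : ℕ}

/-! ## §4 The average to second order -/

section Avg

variable {𝔸 : Type*} [NormedRing 𝔸] [NormedAlgebra ℂ 𝔸] [CompleteSpace 𝔸] [NormOneClass 𝔸]

/-- Every step of the straight walk of `c` reads a two-block bond. [cite: Balaban1984PropagatorsI, (1.7) p.18] -/
theorem two_block_of_mem_lineWalk (hj : j + 1 ≤ P.m + P.K) (c : PBond P (j + 1)) {st : LStep P j}
    (hst : st ∈ walk (emb c.src) (List.replicate P.L (c.dir, true))) :
    (blockOf st.bond.src = c.src ∨ blockOf st.bond.src = c.tgt) ∧ (blockOf st.bond.tgt = c.src ∨ blockOf st.bond.tgt = c.tgt) := by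
  obtain ⟨t, ht, hb⟩ := exists_eq_line_of_mem_walk c hst
  rw [hb]
  exact ⟨blockOf_lineSite hj c ht, T4ReflectionConeSharp.blockOf_tgt_line hj c ht⟩

/-- **[Balaban1985Averaging] PROP. 3 AT THE FLAT BACKGROUND FOR THE UNGUARDED (0.4) AVERAGE ON `𝔸ˣ`-FIELDS**: if `‖S(b) − 1‖ ≤ s` on every bond with both ends
in the two blocks of `c` and `48ℓs ≤ 1` (`ℓ = (d+2)L`), then
`‖Ū(c) − 1 − |I|⁻¹ Σ_{(n,σ,σ′)} [Z(Γ^σ_{y→x}) + Z([x,x′]) − Z(Γ^{σ′}_{y′→x′})]‖ ≤ 660·ℓ²s²` (`Ū = emlAvgU S`, `Z = S − 1`) and `‖Ū(c) − 1‖ ≤ 17·ℓs`.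
[cite: Balaban1985Averaging, Prop. 3 (122)-(125) p.36; Balaban1987RG1, (0.4) p.253] -/
theorem norm_emlAvgU_sub_one_sub_lin_le (hj : j + 1 ≤ P.m + P.K) {S : GaugeField P j 𝔸ˣ} (c : PBond P (j + 1)) {s : ℝ} (hs0 : 0 ≤ s)
    (hℓs : 48 * (((P.d + 2) * P.L : ℕ) : ℝ) * s ≤ 1)
    (hS : ∀ b : PBond P j, (blockOf b.src = c.src ∨ blockOf b.src = c.tgt) → (blockOf b.tgt = c.src ∨ blockOf b.tgt = c.tgt) →
      ‖((S b : 𝔸ˣ) : 𝔸) - 1‖ ≤ s) :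
    ‖((emlAvgU S c : 𝔸ˣ) : 𝔸) - 1 -
        ((Fintype.card (Idx P) : ℂ))⁻¹ • ∑ i : Idx P,
          (walkSum (fun b => ((S b : 𝔸ˣ) : 𝔸) - 1) (walk (emb c.src) (stairWord i.2.1 (off i.1))) +
            walkSum (fun b => ((S b : 𝔸ˣ) : 𝔸) - 1) (walk (walkEnd (emb c.src) (stairWord i.2.1 (off i.1))) (List.replicate P.L (c.dir, true))) -
            walkSum (fun b => ((S b : 𝔸ˣ) : 𝔸) - 1) (walk (emb c.tgt) (stairWord i.2.2 (off i.1))))‖ ≤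
        660 * (((P.d + 2) * P.L : ℕ) : ℝ) ^ 2 * s ^ 2 ∧
      ‖((emlAvgU S c : 𝔸ˣ) : 𝔸) - 1‖ ≤ 17 * (((P.d + 2) * P.L : ℕ) : ℝ) * s := by
  set ℓ : ℝ := (((P.d + 2) * P.L : ℕ) : ℝ) with hℓ
  have hℓ1n : 1 ≤ (P.d + 2) * P.L := Nat.one_le_iff_ne_zero.mpr (Nat.mul_ne_zero (by omega) (by have := P.hL.2; omega))
  have hℓ1 : (1 : ℝ) ≤ ℓ := by rw [hℓ]; exact_mod_cast hℓ1n
  have hℓ0 : 0 ≤ ℓ := by linarith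
  have h4 : 4 * ℓ * s ≤ 1 := by nlinarith [mul_nonneg hℓ0 hs0]
  set Z : PBond P j → 𝔸 := fun b => ((S b : 𝔸ˣ) : 𝔸) - 1 with hZ
  -- letters: the correction factor `E` and the straight transporter `T`
  set E : 𝔸 := eml (fun i : Idx P => ((loopHolU S c i : 𝔸ˣ) : 𝔸)) with hE
  set T : 𝔸 := ((holT S (emb c.src) (List.replicate P.L (c.dir, true)) : 𝔸ˣ) : 𝔸) with hT
  set Sline : 𝔸 := walkSum Z (walk (emb c.src) (List.replicate P.L (c.dir, true))) with hSline
  set Lin : 𝔸 := ((Fintype.card (Idx P) : ℂ))⁻¹ • ∑ i : Idx P,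
      (walkSum Z (walk (emb c.src) (stairWord i.2.1 (off i.1))) +
        walkSum Z (walk (walkEnd (emb c.src) (stairWord i.2.1 (off i.1))) (List.replicate P.L (c.dir, true))) -
        walkSum Z (walk (emb c.tgt) (stairWord i.2.2 (off i.1)))) with hLin
  obtain ⟨hE2, hE1⟩ := norm_eml_loopHolU_sub_one_sub_mean_le hj c hs0 hℓs hS
  -- the mean of the loop sums is `Lin − Sline`
  have hloops : ((Fintype.card (Idx P) : ℂ))⁻¹ • ∑ i : Idx P, walkSum Z (walk (emb c.src) (loopWord P.L c.dir (off i.1) i.2.1 i.2.2)) = Lin - Sline := by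
    simp only [walkSum_walk_loopWord, hLin, hSline]
    rw [Finset.sum_sub_distrib, smul_sub, card_inv_smul_sum_const]
  rw [hloops] at hE2
  -- the straight transporter
  have hLlen : (List.replicate P.L (c.dir, true)).length ≤ (P.d + 2) * P.L := by
    rw [List.length_replicate]; exact Nat.le_mul_of_pos_left _ (by omega)
  obtain ⟨hT1, hT2⟩ := norm_holT_sub_one_sub_walkSum_le_of_length_le (S := S) hs0 hℓ1n (by rwa [← hℓ]) _ (emb c.src) hLlen
    fun st hst => hS st.bond (two_block_of_mem_lineWalk hj c hst).1 (two_block_of_mem_lineWalk hj c hst).2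
  -- the average is `E·T`
  have hU : ((emlAvgU S c : 𝔸ˣ) : 𝔸) = E * T := coe_emlAvgU S c
  -- `Lin` is small: three segments of at most `ℓ` steps
  have hLin3 : ‖Lin‖ ≤ 3 * ℓ * s := by
    refine norm_card_inv_smul_sum_le (by positivity) fun i => ?_
    have hseg : ∀ (y : Site P (j + 1)) (σ : Equiv.Perm (Fin P.d)), (y = c.src ∨ y = c.tgt) →
        ‖walkSum Z (walk (emb y) (stairWord σ (off i.1)))‖ ≤ ℓ * s := by
      intro y σ hy
      refine (norm_walkSum_le_of_steps (s := s) Z _ fun st hst => ?_).trans ?_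
      · obtain ⟨h1, h2⟩ := blockOf_ends_of_mem_stairWalk hj y i.1 σ st hst
        exact hS st.bond (by rw [h1]; exact hy) (by rw [h2]; exact hy)
      · have : ((walk (emb y) (stairWord σ (off i.1))).length : ℝ) ≤ ℓ := by
          rw [hℓ]; exact_mod_cast length_walk_stairWord_le (emb y) σ i.1
        exact mul_le_mul_of_nonneg_right this hs0
    have hA := hseg c.src i.2.1 (Or.inl rfl)
    have hC := hseg c.tgt i.2.2 (Or.inr rfl)
    have hB : ‖walkSum Z (walk (walkEnd (emb c.src) (stairWord i.2.1 (off i.1))) (List.replicate P.L (c.dir, true)))‖ ≤ ℓ * s := by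
      refine (norm_walkSum_le_of_steps (s := s) Z _ fun st hst => ?_).trans ?_
      · have hmem : st ∈ walk (emb c.src) (loopWord P.L c.dir (off i.1) i.2.1 i.2.2) := by
          unfold loopWord; rw [walk_append, walk_append]; simp [hst]
        exact hS st.bond (two_block_of_mem_loopWalk hj c i hmem).1 (two_block_of_mem_loopWalk hj c i hmem).2
      · have : ((walk (walkEnd (emb c.src) (stairWord i.2.1 (off i.1))) (List.replicate P.L (c.dir, true))).length : ℝ) ≤ ℓ := by
          rw [hℓ]; exact_mod_cast length_walk_replicate_le _ c.dir true
        exact mul_le_mul_of_nonneg_right this hs0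
    calc _ ≤ ‖walkSum Z (walk (emb c.src) (stairWord i.2.1 (off i.1))) +
          walkSum Z (walk (walkEnd (emb c.src) (stairWord i.2.1 (off i.1))) (List.replicate P.L (c.dir, true)))‖ +
          ‖walkSum Z (walk (emb c.tgt) (stairWord i.2.2 (off i.1)))‖ := norm_sub_le _ _
      _ ≤ (ℓ * s + ℓ * s) + ℓ * s := add_le_add ((norm_add_le _ _).trans (add_le_add hA hB)) hC
      _ = 3 * ℓ * s := by ring
  constructor
  · have e : E * T - 1 - Lin = (E - 1) * (T - 1) + (E - 1 - (Lin - Sline)) + (T - 1 - Sline) := by noncomm_ring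
    rw [hU, e]
    calc _ ≤ ‖E - 1‖ * ‖T - 1‖ + ‖E - 1 - (Lin - Sline)‖ + ‖T - 1 - Sline‖ :=
          (norm_add_le _ _).trans (add_le_add ((norm_add_le _ _).trans (add_le_add (norm_mul_le _ _) le_rfl)) le_rfl)
      _ ≤ (16 * ℓ * s) * (4 * ℓ * s) + 586 * ℓ ^ 2 * s ^ 2 + 10 * ℓ ^ 2 * s ^ 2 := by
          gcongr
      _ = 660 * ℓ ^ 2 * s ^ 2 := by ring
  · have e : E * T - 1 = (E - 1) * (T - 1) + (E - 1 - (Lin - Sline)) + (T - 1 - Sline) + Lin := by noncomm_ring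
    rw [hU, e]
    calc _ ≤ ‖E - 1‖ * ‖T - 1‖ + ‖E - 1 - (Lin - Sline)‖ + ‖T - 1 - Sline‖ + ‖Lin‖ :=
          (norm_add_le _ _).trans (add_le_add ((norm_add_le _ _).trans (add_le_add ((norm_add_le _ _).trans
            (add_le_add (norm_mul_le _ _) le_rfl)) le_rfl)) le_rfl)
      _ ≤ (16 * ℓ * s) * (4 * ℓ * s) + 586 * ℓ ^ 2 * s ^ 2 + 10 * ℓ ^ 2 * s ^ 2 + 3 * ℓ * s := by
          gcongr
      _ = 660 * (ℓ * s) * (ℓ * s) + 3 * ℓ * s := by ring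
      _ ≤ 660 * (ℓ * s) * (1 / 48) + 3 * ℓ * s := by
          have : ℓ * s ≤ 1 / 48 := by nlinarith [mul_nonneg hℓ0 hs0]
          nlinarith [mul_nonneg hℓ0 hs0]
      _ ≤ 17 * ℓ * s := by nlinarith [mul_nonneg hℓ0 hs0]

end Avg

/-! ## §5 The factorised one step: straight part `×L`, comb means as a coarse gauge -/

section Factorised

variable {𝔸 : Type*} [NormedRing 𝔸] [NormedAlgebra ℂ 𝔸] [CompleteSpace 𝔸] [NormOneClass 𝔸]

omit [NormedAlgebra ℂ 𝔸] [CompleteSpace 𝔸] [NormOneClass 𝔸] in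
/-- A block comb sum `Z(Γ^σ_{y→x})` of a field within `s` of `1` on the bonds INSIDE the block `y` is at most `ℓ·s` (the staircases stay in their block,
`blockOf_ends_of_mem_stairWalk`). [cite: Balaban1985Averaging, (62) p.28; Balaban1987RG1, (0.3) p.252] -/
theorem norm_walkSum_stairWord_le_of_block (hj : j + 1 ≤ P.m + P.K) {S : GaugeField P j 𝔸ˣ} (y : Site P (j + 1)) {s : ℝ} (hs0 : 0 ≤ s)
    (hS : ∀ b : PBond P j, blockOf b.src = y → blockOf b.tgt = y → ‖((S b : 𝔸ˣ) : 𝔸) - 1‖ ≤ s) (σ : Equiv.Perm (Fin P.d)) (r : Fin P.d → Fin P.L) :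
    ‖walkSum (fun b => ((S b : 𝔸ˣ) : 𝔸) - 1) (walk (emb y) (stairWord σ (off r)))‖ ≤ (((P.d + 2) * P.L : ℕ) : ℝ) * s := by
  refine (norm_walkSum_le_of_steps (s := s) _ _ fun st hst => ?_).trans ?_
  · obtain ⟨h1, h2⟩ := blockOf_ends_of_mem_stairWalk hj y r σ st hst
    exact hS st.bond h1 h2
  · have : ((walk (emb y) (stairWord σ (off r))).length : ℝ) ≤ (((P.d + 2) * P.L : ℕ) : ℝ) := by
      exact_mod_cast length_walk_stairWord_le (emb y) σ r
    exact mul_le_mul_of_nonneg_right this hs0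

omit [CompleteSpace 𝔸] [NormOneClass 𝔸] in
/-- The block comb MEAN `λ̄(y) = |I|⁻¹ Σ Z(Γ^σ_{y→x})` of a field within `s` of `1` inside the block `y` is at most `ℓ·s`. [cite: Balaban1985Averaging, (62) p.28] -/
theorem norm_combSum_mean_le_of_block (hj : j + 1 ≤ P.m + P.K) {S : GaugeField P j 𝔸ˣ} (y : Site P (j + 1)) {s : ℝ} (hs0 : 0 ≤ s)
    (hS : ∀ b : PBond P j, blockOf b.src = y → blockOf b.tgt = y → ‖((S b : 𝔸ˣ) : 𝔸) - 1‖ ≤ s) :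
    ‖((Fintype.card (Idx P) : ℂ))⁻¹ • ∑ i : Idx P, walkSum (fun b => ((S b : 𝔸ˣ) : 𝔸) - 1) (walk (emb y) (stairWord i.2.1 (off i.1)))‖ ≤
      (((P.d + 2) * P.L : ℕ) : ℝ) * s :=
  norm_card_inv_smul_sum_le (by positivity) fun i => norm_walkSum_stairWord_le_of_block hj y hs0 hS i.2.1 i.1

omit [NormedAlgebra ℂ 𝔸] [CompleteSpace 𝔸] [NormOneClass 𝔸] in
/-- A block comb sum `Z(Γ^σ_{y→x})` of a field within `s` of `1` on the two-block bonds of `c`, `y ∈ {c₋, c₊}`, is at most `ℓ·s`. [cite: Balaban1985Averaging, (62) p.28] -/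
theorem norm_walkSum_stairWord_le (hj : j + 1 ≤ P.m + P.K) {S : GaugeField P j 𝔸ˣ} (c : PBond P (j + 1)) {s : ℝ} (hs0 : 0 ≤ s)
    (hS : ∀ b : PBond P j, (blockOf b.src = c.src ∨ blockOf b.src = c.tgt) → (blockOf b.tgt = c.src ∨ blockOf b.tgt = c.tgt) →
      ‖((S b : 𝔸ˣ) : 𝔸) - 1‖ ≤ s) {y : Site P (j + 1)} (hy : y = c.src ∨ y = c.tgt) (σ : Equiv.Perm (Fin P.d)) (r : Fin P.d → Fin P.L) :
    ‖walkSum (fun b => ((S b : 𝔸ˣ) : 𝔸) - 1) (walk (emb y) (stairWord σ (off r)))‖ ≤ (((P.d + 2) * P.L : ℕ) : ℝ) * s :=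
  norm_walkSum_stairWord_le_of_block hj y hs0 (fun b h1 h2 => hS b (by rw [h1]; exact hy) (by rw [h2]; exact hy)) σ r

omit [NormedAlgebra ℂ 𝔸] [CompleteSpace 𝔸] [NormOneClass 𝔸] in
/-- **THE STRAIGHT SEGMENTS `[x, x′]` HAVE EXACTLY `L` BONDS**: `‖Z([x, x′])‖ ≤ L·s` (the constant `L` of the one-step propagation).
[cite: Balaban1987RG1, (0.4) p.253; Balaban1984PropagatorsI, (1.11) p.19] -/
theorem norm_walkSum_seg_le (hj : j + 1 ≤ P.m + P.K) {S : GaugeField P j 𝔸ˣ} (c : PBond P (j + 1)) {s : ℝ}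
    (hS : ∀ b : PBond P j, (blockOf b.src = c.src ∨ blockOf b.src = c.tgt) → (blockOf b.tgt = c.src ∨ blockOf b.tgt = c.tgt) →
      ‖((S b : 𝔸ˣ) : 𝔸) - 1‖ ≤ s) (i : Idx P) :
    ‖walkSum (fun b => ((S b : 𝔸ˣ) : 𝔸) - 1) (walk (walkEnd (emb c.src) (stairWord i.2.1 (off i.1))) (List.replicate P.L (c.dir, true)))‖ ≤
      (P.L : ℝ) * s := by
  refine (norm_walkSum_le_of_steps (s := s) _ _ fun st hst => ?_).trans ?_
  · have hmem : st ∈ walk (emb c.src) (loopWord P.L c.dir (off i.1) i.2.1 i.2.2) := by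
      unfold loopWord; rw [walk_append, walk_append]; simp [hst]
    exact hS st.bond (two_block_of_mem_loopWalk hj c i hmem).1 (two_block_of_mem_loopWalk hj c i hmem).2
  · rw [length_walk, List.length_replicate]

omit [NormOneClass 𝔸] in
/-- `‖exp(Y) − 1‖ ≤ 2‖Y‖` and `‖exp(Y) − 1 − Y‖ ≤ ‖Y‖²` for `‖Y‖ ≤ 1` (termwise). [folklore] -/
theorem norm_exp_sub_one_sub_le_sq {Y : 𝔸} (hY : ‖Y‖ ≤ 1) : ‖exp Y - 1‖ ≤ 2 * ‖Y‖ ∧ ‖exp Y - 1 - Y‖ ≤ ‖Y‖ ^ 2 := by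
  refine ⟨norm_exp_sub_one_le_two_mul hY, (norm_exp_sub_one_sub_self_le Y).trans ?_⟩
  have h := Real.abs_exp_sub_one_sub_id_le (x := ‖Y‖) (by rwa [abs_of_nonneg (norm_nonneg _)])
  exact (le_abs_self _).trans h

/-- **THE FACTORISED ONE STEP ([Balaban1985Averaging] Prop. 3 with the comb means as a coarse gauge).**  Let `‖S(b) − 1‖ ≤ s` on the two-block bonds of
`c = ⟨y, y′⟩`, `48ℓs ≤ 1`, `Z = S − 1`, and let `λ̄(y) = |I|⁻¹ Σ_{(n,σ,·)} Z(Γ^σ_{y→y+n})` be the block comb mean (`combMean Z y` for matrices; it depends on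
`S` inside the block `y` only).  Then, with the coarse gauge `g(y) = exp(λ̄(y))`,
`‖exp(−λ̄(y))·Ū(c)·exp(λ̄(y′)) − 1‖ ≤ L·s + 800·ℓ²s²` and `‖λ̄(y)‖, ‖λ̄(y′)‖ ≤ ℓ·s`:
conjugating away the comb means leaves the mean of the straight segments `[x, x′]` — `L` bonds each — to first order.  Iterated with the covariance
`emlAvgU (S^H) = (emlAvgU S)^{H∘emb}` this is the k-uniform propagation of near-flatness (`×L` per level, summable second order).
[cite: Balaban1985Averaging, Prop. 3 (122)-(125) p.36, (62)-(63) p.28; Balaban1987RG1, (0.4) p.253] -/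
theorem norm_conj_emlAvgU_sub_one_le (hj : j + 1 ≤ P.m + P.K) {S : GaugeField P j 𝔸ˣ} (c : PBond P (j + 1)) {s : ℝ} (hs0 : 0 ≤ s)
    (hℓs : 48 * (((P.d + 2) * P.L : ℕ) : ℝ) * s ≤ 1)
    (hS : ∀ b : PBond P j, (blockOf b.src = c.src ∨ blockOf b.src = c.tgt) → (blockOf b.tgt = c.src ∨ blockOf b.tgt = c.tgt) →
      ‖((S b : 𝔸ˣ) : 𝔸) - 1‖ ≤ s) :
    ‖exp (-(((Fintype.card (Idx P) : ℂ))⁻¹ • ∑ i : Idx P,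
            walkSum (fun b => ((S b : 𝔸ˣ) : 𝔸) - 1) (walk (emb c.src) (stairWord i.2.1 (off i.1))))) *
        ((emlAvgU S c : 𝔸ˣ) : 𝔸) *
        exp (((Fintype.card (Idx P) : ℂ))⁻¹ • ∑ i : Idx P,
            walkSum (fun b => ((S b : 𝔸ˣ) : 𝔸) - 1) (walk (emb c.tgt) (stairWord i.2.1 (off i.1)))) - 1‖ ≤
        (P.L : ℝ) * s + 800 * (((P.d + 2) * P.L : ℕ) : ℝ) ^ 2 * s ^ 2 ∧
      ‖((Fintype.card (Idx P) : ℂ))⁻¹ • ∑ i : Idx P,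
          walkSum (fun b => ((S b : 𝔸ˣ) : 𝔸) - 1) (walk (emb c.src) (stairWord i.2.1 (off i.1)))‖ ≤ (((P.d + 2) * P.L : ℕ) : ℝ) * s ∧
      ‖((Fintype.card (Idx P) : ℂ))⁻¹ • ∑ i : Idx P,
          walkSum (fun b => ((S b : 𝔸ˣ) : 𝔸) - 1) (walk (emb c.tgt) (stairWord i.2.1 (off i.1)))‖ ≤ (((P.d + 2) * P.L : ℕ) : ℝ) * s := by
  set ℓ : ℝ := (((P.d + 2) * P.L : ℕ) : ℝ) with hℓ
  have hℓ0 : 0 ≤ ℓ := Nat.cast_nonneg _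
  have hℓs1 : ℓ * s ≤ 1 / 48 := by nlinarith [mul_nonneg hℓ0 hs0]
  set Z : PBond P j → 𝔸 := fun b => ((S b : 𝔸ˣ) : 𝔸) - 1 with hZ
  set a : 𝔸 := ((Fintype.card (Idx P) : ℂ))⁻¹ • ∑ i : Idx P, walkSum Z (walk (emb c.src) (stairWord i.2.1 (off i.1))) with ha
  set a' : 𝔸 := ((Fintype.card (Idx P) : ℂ))⁻¹ • ∑ i : Idx P, walkSum Z (walk (emb c.tgt) (stairWord i.2.1 (off i.1))) with ha'
  set B : 𝔸 := ((Fintype.card (Idx P) : ℂ))⁻¹ • ∑ i : Idx P,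
    walkSum Z (walk (walkEnd (emb c.src) (stairWord i.2.1 (off i.1))) (List.replicate P.L (c.dir, true))) with hB
  set Lin : 𝔸 := ((Fintype.card (Idx P) : ℂ))⁻¹ • ∑ i : Idx P,
      (walkSum Z (walk (emb c.src) (stairWord i.2.1 (off i.1))) +
        walkSum Z (walk (walkEnd (emb c.src) (stairWord i.2.1 (off i.1))) (List.replicate P.L (c.dir, true))) -
        walkSum Z (walk (emb c.tgt) (stairWord i.2.2 (off i.1)))) with hLin
  -- sizes of the comb means and of the straight mean
  have ha1 : ‖a‖ ≤ ℓ * s := norm_card_inv_smul_sum_le (by positivity) fun i => norm_walkSum_stairWord_le hj c hs0 hS (Or.inl rfl) i.2.1 i.1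
  have ha'1 : ‖a'‖ ≤ ℓ * s := norm_card_inv_smul_sum_le (by positivity) fun i => norm_walkSum_stairWord_le hj c hs0 hS (Or.inr rfl) i.2.1 i.1
  have hB1 : ‖B‖ ≤ (P.L : ℝ) * s :=
    norm_card_inv_smul_sum_le (by have := P.L_pos; positivity) fun i => norm_walkSum_seg_le hj c hS i
  -- `Lin = a + B − a'` (the third family re-indexed `σ′ ↦ σ`)
  have hLin_eq : Lin = a + B - a' := by
    simp only [hLin, ha, hB, ha', Finset.sum_sub_distrib, Finset.sum_add_distrib, smul_sub, smul_add]
    rw [sum_idx_swap (fun r σ => walkSum Z (walk (emb c.tgt) (stairWord σ (off r))))]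
  -- the average to second order
  obtain ⟨hM2, hM1⟩ := norm_emlAvgU_sub_one_sub_lin_le hj c hs0 hℓs hS
  set M : 𝔸 := ((emlAvgU S c : 𝔸ˣ) : 𝔸) - 1 with hM
  have hM2' : ‖M - Lin‖ ≤ 660 * ℓ ^ 2 * s ^ 2 := hM2
  -- the exponentials of the comb means
  have ha_le1 : ‖-a‖ ≤ 1 := by rw [norm_neg]; linarith
  have ha'_le1 : ‖a'‖ ≤ 1 := by linarith
  obtain ⟨hX1, hX2⟩ := norm_exp_sub_one_sub_le_sq ha_le1
  obtain ⟨hX'1, hX'2⟩ := norm_exp_sub_one_sub_le_sq ha'_le1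
  rw [norm_neg] at hX1 hX2
  set X : 𝔸 := exp (-a) - 1 with hX
  set X' : 𝔸 := exp a' - 1 with hX'
  refine ⟨?_, ha1, ha'1⟩
  have hU : ((emlAvgU S c : 𝔸ˣ) : 𝔸) = 1 + M := by rw [hM, add_sub_cancel]
  have e : exp (-a) * ((emlAvgU S c : 𝔸ˣ) : 𝔸) * exp a' - 1 =
      (X - (-a)) + (M - Lin) + (X' - a') + (Lin - a + a') + (X * M + X * X' + M * X' + X * M * X') := by
    rw [hU, show exp (-a) = 1 + X by rw [hX, add_sub_cancel], show exp a' = 1 + X' by rw [hX', add_sub_cancel]]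
    noncomm_ring
  have hB' : Lin - a + a' = B := by rw [hLin_eq]; abel
  rw [e, hB']
  have hXa : ‖X‖ ≤ 2 * (ℓ * s) := hX1.trans (by linarith)
  have hX'a : ‖X'‖ ≤ 2 * (ℓ * s) := hX'1.trans (by linarith)
  have hXa2 : ‖X - (-a)‖ ≤ (ℓ * s) ^ 2 := hX2.trans (by nlinarith [norm_nonneg a])
  have hX'a2 : ‖X' - a'‖ ≤ (ℓ * s) ^ 2 := hX'2.trans (by nlinarith [norm_nonneg a'])
  have hM1' : ‖M‖ ≤ 17 * (ℓ * s) := by rw [hM]; linarith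
  have hls0 : 0 ≤ ℓ * s := mul_nonneg hℓ0 hs0
  have hprod : ‖X * M + X * X' + M * X' + X * M * X'‖ ≤ 74 * (ℓ * s) ^ 2 := by
    have h1 : ‖X * M‖ ≤ 2 * (ℓ * s) * (17 * (ℓ * s)) := (norm_mul_le _ _).trans (mul_le_mul hXa hM1' (norm_nonneg _) (by positivity))
    have h2 : ‖X * X'‖ ≤ 2 * (ℓ * s) * (2 * (ℓ * s)) := (norm_mul_le _ _).trans (mul_le_mul hXa hX'a (norm_nonneg _) (by positivity))
    have h3 : ‖M * X'‖ ≤ 17 * (ℓ * s) * (2 * (ℓ * s)) := (norm_mul_le _ _).trans (mul_le_mul hM1' hX'a (norm_nonneg _) (by positivity))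
    have h4 : ‖X * M * X'‖ ≤ 2 * (ℓ * s) * (17 * (ℓ * s)) * (2 * (ℓ * s)) :=
      (norm_mul_le _ _).trans (mul_le_mul h1 hX'a (norm_nonneg _) (by positivity))
    calc _ ≤ ‖X * M‖ + ‖X * X'‖ + ‖M * X'‖ + ‖X * M * X'‖ :=
          (norm_add_le _ _).trans (add_le_add ((norm_add_le _ _).trans (add_le_add (norm_add_le _ _) le_rfl)) le_rfl)
      _ ≤ 2 * (ℓ * s) * (17 * (ℓ * s)) + 2 * (ℓ * s) * (2 * (ℓ * s)) + 17 * (ℓ * s) * (2 * (ℓ * s)) +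
            2 * (ℓ * s) * (17 * (ℓ * s)) * (2 * (ℓ * s)) := add_le_add (add_le_add (add_le_add h1 h2) h3) h4
      _ = 72 * (ℓ * s) ^ 2 + 68 * (ℓ * s) ^ 2 * (ℓ * s) := by ring
      _ ≤ 72 * (ℓ * s) ^ 2 + 68 * (ℓ * s) ^ 2 * (1 / 48) := by gcongr
      _ ≤ 74 * (ℓ * s) ^ 2 := by nlinarith [sq_nonneg (ℓ * s)]
  calc _ ≤ ‖X - (-a)‖ + ‖M - Lin‖ + ‖X' - a'‖ + ‖B‖ + ‖X * M + X * X' + M * X' + X * M * X'‖ :=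
        (norm_add_le _ _).trans (add_le_add ((norm_add_le _ _).trans (add_le_add ((norm_add_le _ _).trans
          (add_le_add (norm_add_le _ _) le_rfl)) le_rfl)) le_rfl)
    _ ≤ (ℓ * s) ^ 2 + 660 * ℓ ^ 2 * s ^ 2 + (ℓ * s) ^ 2 + (P.L : ℝ) * s + 74 * (ℓ * s) ^ 2 :=
        add_le_add (add_le_add (add_le_add (add_le_add hXa2 hM2') hX'a2) hB1) hprod
    _ = (P.L : ℝ) * s + 736 * ℓ ^ 2 * s ^ 2 := by ring
    _ ≤ (P.L : ℝ) * s + 800 * ℓ ^ 2 * s ^ 2 := by nlinarith [sq_nonneg (ℓ * s)]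

end Factorised

/-! ## §6 Matrix algebras: the same through `linAvg` and `combMean` -/

section MatrixForm

open scoped Matrix.Norms.L2Operator

variable {n : Type*} [Fintype n] [DecidableEq n] [Nonempty n]

/-- **PROP. 3 FOR THE UNGUARDED AVERAGE ON `GL_N(ℂ) ⊂ M_N(ℂ)`-VALUED FIELDS, IN THE TREE'S LETTERS**: `‖Ū(c) − 1 − (Q₁Z)(c)‖ ≤ 660·ℓ²s²` with
`Q₁ = BlockAveragingEMLLinearised.linAvg` (`L²`-operator norm). [cite: Balaban1985Averaging, Prop. 3 (122)-(125) p.36] -/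
theorem norm_emlAvgU_sub_one_sub_linAvg_le (hj : j + 1 ≤ P.m + P.K) {S : GaugeField P j (Matrix n n ℂ)ˣ} (c : PBond P (j + 1)) {s : ℝ}
    (hs0 : 0 ≤ s) (hℓs : 48 * (((P.d + 2) * P.L : ℕ) : ℝ) * s ≤ 1)
    (hS : ∀ b : PBond P j, (blockOf b.src = c.src ∨ blockOf b.src = c.tgt) → (blockOf b.tgt = c.src ∨ blockOf b.tgt = c.tgt) →
      ‖((S b : (Matrix n n ℂ)ˣ) : Matrix n n ℂ) - 1‖ ≤ s) :
    ‖((emlAvgU S c : (Matrix n n ℂ)ˣ) : Matrix n n ℂ) - 1 - linAvg (fun b => ((S b : (Matrix n n ℂ)ˣ) : Matrix n n ℂ) - 1) c‖ ≤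
        660 * (((P.d + 2) * P.L : ℕ) : ℝ) ^ 2 * s ^ 2 ∧
      ‖((emlAvgU S c : (Matrix n n ℂ)ˣ) : Matrix n n ℂ) - 1‖ ≤ 17 * (((P.d + 2) * P.L : ℕ) : ℝ) * s := by
  rw [linAvg_def]
  exact norm_emlAvgU_sub_one_sub_lin_le hj c hs0 hℓs hS

/-- **THE FACTORISED ONE STEP ON `GL_N(ℂ)`-VALUED FIELDS, IN THE TREE'S LETTERS**: with `λ̄ = combMean (S − 1)`,
`‖exp(−λ̄(c₋))·Ū(c)·exp(λ̄(c₊)) − 1‖ ≤ L·s + 800·ℓ²s²` and `‖λ̄(c_±)‖ ≤ ℓ·s`. [cite: Balaban1985Averaging, Prop. 3 (122)-(125) p.36, (62)-(63) p.28] -/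
theorem norm_conj_emlAvgU_sub_one_le_combMean (hj : j + 1 ≤ P.m + P.K) {S : GaugeField P j (Matrix n n ℂ)ˣ} (c : PBond P (j + 1)) {s : ℝ}
    (hs0 : 0 ≤ s) (hℓs : 48 * (((P.d + 2) * P.L : ℕ) : ℝ) * s ≤ 1)
    (hS : ∀ b : PBond P j, (blockOf b.src = c.src ∨ blockOf b.src = c.tgt) → (blockOf b.tgt = c.src ∨ blockOf b.tgt = c.tgt) →
      ‖((S b : (Matrix n n ℂ)ˣ) : Matrix n n ℂ) - 1‖ ≤ s) :
    ‖exp (-combMean (fun b => ((S b : (Matrix n n ℂ)ˣ) : Matrix n n ℂ) - 1) c.src) * ((emlAvgU S c : (Matrix n n ℂ)ˣ) : Matrix n n ℂ) *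
        exp (combMean (fun b => ((S b : (Matrix n n ℂ)ˣ) : Matrix n n ℂ) - 1) c.tgt) - 1‖ ≤
        (P.L : ℝ) * s + 800 * (((P.d + 2) * P.L : ℕ) : ℝ) ^ 2 * s ^ 2 ∧
      ‖combMean (fun b => ((S b : (Matrix n n ℂ)ˣ) : Matrix n n ℂ) - 1) c.src‖ ≤ (((P.d + 2) * P.L : ℕ) : ℝ) * s ∧
      ‖combMean (fun b => ((S b : (Matrix n n ℂ)ˣ) : Matrix n n ℂ) - 1) c.tgt‖ ≤ (((P.d + 2) * P.L : ℕ) : ℝ) * s := by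
  rw [combMean_def, combMean_def]
  exact norm_conj_emlAvgU_sub_one_le hj c hs0 hℓs hS

end MatrixForm

end Summit.QuantumFields.YangMills.Theorems.Prop8Chart

end
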